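import Literature.MathematicalPhysics.QuantumFieldTheory.Balaban1983to89.B9SectBGStepCodedF
import Literature.MathematicalPhysics.QuantumFieldTheory.Balaban1983to89.B9Ineq347BondReadingY
import Literature.MathematicalPhysics.QuantumFieldTheory.Balaban1983to89.B9SectBStepPosFamilyTransfer

/-!
# Balaban [B9], Thm 3.4 p. 400 with (3.47) p. 398 — THE (3.47) MEMBER OF THE SECT.-B STEP OF RECORD FOR THE BOND SECTOR `KACU` (print's reading R13-U1),
# ROUTE F: `KACU_glob_prod_eq`, ★ `globBlock_KACU_prod_of_eBlock`, ★★ `stepGlobPos_KACU_of_385`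

T. Bałaban, *Propagators for lattice gauge theories in a background field*, Commun. Math. Phys. **99** (1985) 389–434
[`Balaban1985BackgroundPropagators`, "B9"]; [4] = T. Bałaban, *Propagators and renormalization transformations for lattice gauge
theories. II*, Commun. Math. Phys. **96** (1984) 223–250 [`Balaban1984PropagatorsII`].

statement-level skeleton of published theorems with citation tags; proofs where landed; nothing here is a claim about the
Yang–Mills mass gap

THE PRINTED LOCI.  p. 398: *«the global inequalities (3.47) are consequences of the local ones (3.42) and Lemma 2.1»*; p. 407: *«This way we get all these
inequalities for the operator G(U′U), the local ones follow from the bound (3.85) and Lemma 2.1 [4].»*; Thm 3.4 p. 400.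

WHY THIS FILE (pub-ymgap N06 row 13, G side; seat dag-n06-c gen 13).  `B9SectBGStepCodedF.stepEPos_KACU_of_385` gave the (3.42)-step for the bond-sector
reading `KACU` from the displayed (3.85); the (3.47)-step (`hGa` slot of `sectBStepPrinted_of_posBlockSteps` for `SectBStepU`) follows WITHOUT further
letters: at a coded product the (3.47) members of `KACU` ARE those of NODE 00's one-configuration bond reading of the CONSTANT letter `G(W)`, `W = e^{iηa}U`,
read through `baseY` (`KACU_glob_prod_eq`, `rfl` — the (3.42) twin is gen 12's `B9SectBGReadY.KACU_e_prod_eq`), for which `B9Ineq347BondReadingY.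
globBlock_kernelFamilyB_of_eBlock` turns the (3.42) block into the (3.47) block above a threshold depending on the rate only (`globBlock_KACU_prod_of_eBlock`);
the generic step transfer `B9SectBStepPosFamilyTransfer.stepPos_blk_of_family_pos` does the threshold bookkeeping (`stepGlobPos_KACU_of_385`).

HONEST SCOPE.  Bookkeeping over gen 13's (3.42)-step; the displayed hypotheses are the same (`hunitA`, `h385 : Step385F …`).  Count-neutral; N06 NOT discharged;
nothing continuum ∕ OS ∕ mass-gap ∕ Clay.  No `sorry`, no `axiom`, no `def`, no `instance`.  Seat dag-n06-c g13, 2026-08-28; `--supports stmt-QuantumFields-27364`.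
-/

noncomputable section

namespace Literature.MathematicalPhysics.QuantumFieldTheory.Balaban1983to89.B9SectBGStepCodedFGlob

open Literature.MathematicalPhysics.QuantumFieldTheory.Balaban1983to89
open Literature.MathematicalPhysics.QuantumFieldTheory.Balaban1983to89.B6Ineq2142KLevelV1 (β)
open Literature.MathematicalPhysics.QuantumFieldTheory.Balaban1983to89.B9FromB6 (EBlock GlobBlock)
open Literature.MathematicalPhysics.QuantumFieldTheory.Balaban1983to89.B9SectBCodedCarrier (CCfg Coding pullS)
open Literature.MathematicalPhysics.QuantumFieldTheory.Balaban1983to89.B9Eq360DeltaPrimeAY (AfldY)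
open Literature.MathematicalPhysics.QuantumFieldTheory.Balaban1983to89.B9PinMembersKLevelV1 (MemberY geo9Y bg9Y)
open Literature.MathematicalPhysics.QuantumFieldTheory.Balaban1983to89.B9SectBGpLettersY (GVal decY)
open Literature.MathematicalPhysics.QuantumFieldTheory.Balaban1983to89.B9SectBGpFrameCodedY (codingYx)
open Literature.MathematicalPhysics.QuantumFieldTheory.Balaban1983to89.B9SectBGpReadingsY (baseY)
open Literature.MathematicalPhysics.QuantumFieldTheory.Balaban1983to89.B9SectBCodedReadingsU (KSCU KACU)
open Literature.MathematicalPhysics.QuantumFieldTheory.Balaban1983to89.B9SectBGReadY (KACU_e_prod_eq)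
open Literature.MathematicalPhysics.QuantumFieldTheory.Balaban1983to89.B9SectBGStepCodedF (Step385F stepEPos_KACU_of_385)
open Literature.MathematicalPhysics.QuantumFieldTheory.Balaban1983to89.B9Ineq347BondReadingY (globBlock_kernelFamilyB_of_eBlock)
open Literature.MathematicalPhysics.QuantumFieldTheory.Balaban1983to89.B9SectBStepPosFamilyTransfer (stepPos_blk_of_family_pos)
open Literature.MathematicalPhysics.QuantumFieldTheory.Balaban1983to89.B9SectBStepWhole (StepPos StepEPos StepGlobPos)
open Literature.MathematicalPhysics.QuantumFieldTheory.Balaban1983to89.B9GeoNormsKLevelV1 (geo9K_wNorm_nonneg)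
open Literature.MathematicalPhysics.QuantumFieldTheory.Balaban1983to89.Node00 (SiteY BlkY FBondY IBondY CfgY SiteParY BondParY SiteOpY BondOpY deltaAY GAY
  kernelFamilyB)

variable {d ℓ : ℕ} {hd : 1 ≤ d + 1} {hL : Odd (ℓ + 1) ∧ 1 < ℓ + 1} {b₀ b₁ : ℝ} {Mstar : ℕ}
variable {𝔸 : Type} [NormedRing 𝔸] [NormedAlgebra ℂ 𝔸] [CompleteSpace 𝔸] [FiniteDimensional ℝ 𝔸]
variable {ι : Type} [Fintype ι]

/-! ## §1 The (3.47) members of `KACU` at a coded product and the (3.47) block from the (3.42) block there -/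

section Member

variable (G : Subgroup 𝔸ˣ) (x : MemberY d ℓ hd hL b₀ b₁ Mstar) (OA : BondOpY 𝔸 x.toKIdx) (parB : BondParY 𝔸 x.toKIdx)
  (C37 C38 : ℝ → CfgY 𝔸 x.toKIdx → AfldY 𝔸 x.toKIdx → Prop)

omit [FiniteDimensional ℝ 𝔸] in
/-- at a coded product the (3.47) members of `KACU` (U-letters: differences at the base `U`, operator at the decoded product `W`) ARE those of NODE 00's
one-configuration bond reading of the CONSTANT letter `OA(W)` over the coded carrier read through `baseY` (`rfl`; the (3.42) twin is `B9SectBGReadY.KACU_e_prod_eq`).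
[cite: Balaban1985BackgroundPropagators, Thm 3.4 p.400, (3.47) p.398, bookkeeping] -/
theorem KACU_glob_prod_eq (n : Fin 4) (U : CfgY 𝔸 x.toKIdx) (a : AfldY 𝔸 x.toKIdx) (lam : (geo9Y x).Loc) (γ : ℝ) :
    (KACU G x OA parB C37 C38).glob n (.prod U a) lam γ =
      (kernelFamilyB x.toKIdx (codingYx G x C37 C38).bg (baseY x.toKIdx) (fun _ => OA (decY x.toKIdx (.prod U a))) parB).glob n (.prod U a) lam γ := rfl

omit [FiniteDimensional ℝ 𝔸] in
/-- the (3.47) block is monotone in its constant (the weighted norms are nonnegative). [cite: Balaban1985BackgroundPropagators, (3.47) p.398, bookkeeping] -/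
theorem globBlock_mono_const {B₀ B₀' : ℝ} {c : (codingYx G x C37 C38).bg.Cfg} (h : GlobBlock (KACU G x OA parB C37 C38) B₀ c) (hle : B₀ ≤ B₀') :
    GlobBlock (KACU G x OA parB C37 C38) B₀' c :=
  fun n lam γ h1 h2 => (h n lam γ h1 h2).trans (mul_le_mul_of_nonneg_right hle (geo9K_wNorm_nonneg x.toKIdx γ lam))

/-- ★ **THE (3.47) BLOCK OF `KACU` AT A CODED PRODUCT FROM ITS (3.42) BLOCK THERE**, one threshold per rate: for every `δ > 0` there are `Mg`, `Cg ≥ 0` such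
that at every member with a section of `β` above `Mg`, every `(U, a)`, every `B ≥ 0`: `EBlock KACU B δ (prod U a) → GlobBlock KACU (B·Cg) (prod U a)`
(`B9Ineq347BondReadingY.globBlock_kernelFamilyB_of_eBlock` at the frozen letter `OA(W)`). [cite: Balaban1985BackgroundPropagators, (3.47) p.398 («consequences of the local ones (3.42) and Lemma 2.1»), Thm 3.4 p.400; Balaban1984PropagatorsII, Lemma 2.1 p.234] -/
theorem globBlock_KACU_prod_of_eBlock [∀ x : MemberY d ℓ hd hL b₀ b₁ Mstar, Fintype (geo9Y x).Site] {δ : ℝ} (hδ : 0 < δ) :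
    ∃ Mg Cg : ℝ, 0 ≤ Cg ∧
      ∀ (x : MemberY d ℓ hd hL b₀ b₁ Mstar) (ιB : BlkY x.toKIdx → IBondY x.toKIdx),
        (∀ s : BlkY x.toKIdx, β x.toKIdx.hN x.toKIdx.D x.toKIdx.hk (ιB s) = s) → Mg ≤ (geo9Y x).M →
        ∀ (OA : BondOpY 𝔸 x.toKIdx) (parB : BondParY 𝔸 x.toKIdx) (C37 C38 : ℝ → CfgY 𝔸 x.toKIdx → AfldY 𝔸 x.toKIdx → Prop)
          (U : CfgY 𝔸 x.toKIdx) (a : AfldY 𝔸 x.toKIdx) (B : ℝ), 0 ≤ B →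
          EBlock (KACU G x OA parB C37 C38) B δ (.prod U a) → GlobBlock (KACU G x OA parB C37 C38) (B * Cg) (.prod U a) := by
  obtain ⟨Mg, Cg, hCg, H⟩ := globBlock_kernelFamilyB_of_eBlock (𝔸 := 𝔸) (d := d) (ℓ := ℓ) (hd := hd) (hL := hL) (b₀ := b₀) (b₁ := b₁) (Mstar := Mstar) hδ
  refine ⟨Mg, Cg, hCg, fun x ιB hι hM OA parB C37 C38 U a B hB hE => ?_⟩
  -- the (3.42) block of the frozen one-configuration reading at the coded product
  have hE' : EBlock (kernelFamilyB x.toKIdx (codingYx G x C37 C38).bg (baseY x.toKIdx) (fun _ => OA (decY x.toKIdx (.prod U a))) parB) B δ (.prod U a) := by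
    intro n lam y y' hs
    rw [← KACU_e_prod_eq]
    exact hE n lam y y' hs
  have hG := H x ιB hι hM (codingYx G x C37 C38).bg (baseY x.toKIdx) (fun _ => OA (decY x.toKIdx (.prod U a))) parB (.prod U a) B hB hE'
  intro n lam γ h1 h2
  rw [KACU_glob_prod_eq]
  exact hG n lam γ h1 h2

end Member

/-! ## §2 ★★ The positive-input (3.47)-step for `KACU` over the coded carrier, from the displayed (3.85) -/

section Step

variable {J : Type} (f : J → MemberY d ℓ hd hL b₀ b₁ Mstar) [∀ x : MemberY d ℓ hd hL b₀ b₁ Mstar, Fintype (geo9Y x).Site]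
  (dB : ℕ) (c35 : ℝ) (G : Subgroup 𝔸ˣ) (b : Module.Basis ι ℝ 𝔸)
  (par parS : ∀ j : J, SiteParY 𝔸 (f j).toKIdx) (parB : ∀ j : J, BondParY 𝔸 (f j).toKIdx) (GpS : ∀ j : J, SiteOpY 𝔸 (f j).toKIdx)
  (ιB : ∀ j : J, BlkY (f j).toKIdx → IBondY (f j).toKIdx)
  (C37 C38 : ∀ j : J, ℝ → CfgY 𝔸 (f j).toKIdx → AfldY 𝔸 (f j).toKIdx → Prop)
  (Cinv : ∀ j : J, B9.SiteKernel (geo9Y (f j)) (bg9Y 𝔸 G (f j)))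

/-- ★★ **THE POSITIVE-INPUT (3.47)-STEP `StepGlobPos` FOR THE BOND-SECTOR FAMILY `KACU` OF THE SECT.-B STEP OF RECORD, FROM THE DISPLAYED (3.85)** — the
`hGa` slot of `B9SectBStepWhole.sectBStepPrinted_of_posBlockSteps` for `SectBStepU`: the (3.42)-step of `B9SectBGStepCodedF.stepEPos_KACU_of_385` followed, at
the coded product, by «(3.47) from (3.42) and Lemma 2.1» for the frozen bond letter (`globBlock_KACU_prod_of_eBlock`); thresholds merged by the generic transfer
`stepPos_blk_of_family_pos` (input families unchanged). Same structural and displayed binders as the (3.42)-step.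
[cite: Balaban1985BackgroundPropagators, Thm 3.4 p.400 + (3.47) p.398 + (3.85)–(3.86) p.407; Balaban1984PropagatorsII, Lemma 2.1 p.234] -/
theorem stepGlobPos_KACU_of_385 [DecidableEq ι]
    (hι : ∀ (j : J) (s : BlkY (f j).toKIdx), β (f j).toKIdx.hN (f j).toKIdx.D (f j).toKIdx.hk (ιB j s) = s)
    {M₂ : ℝ} (hM₂ : 0 ≤ M₂) (hrepr : ∀ (v : 𝔸) (j : ι), |b.repr v j| ≤ M₂ * ‖v‖) (hcR : 0 < M₂ * ∑ j, ‖b j‖)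
    (hunitA : ∀ j (U : CfgY 𝔸 (f j).toKIdx), GVal G (f j).toKIdx U → IsUnit (deltaAY (f j).toKIdx (parS j) (parB j) (GpS j) U))
    (h385 : Step385F f dB c35 G b par parS parB GpS ιB C37 C38 Cinv) :
    StepGlobPos dB c35 (fun j => geo9Y (f j)) (fun j => (codingYx G (f j) (C37 j) (C38 j)).bg)
      (fun j => KSCU G (f j) (par j) (C37 j) (C38 j))
      (fun j => KACU G (f j) (GAY (f j).toKIdx (parS j) (parB j) (GpS j)) (parB j) (C37 j) (C38 j))
      (fun j => pullS (codingYx G (f j) (C37 j) (C38 j)) (Cinv j))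
      (fun j => KACU G (f j) (GAY (f j).toKIdx (parS j) (parB j) (GpS j)) (parB j) (C37 j) (C38 j)) := by
  refine stepPos_blk_of_family_pos dB c35 (fun j => geo9Y (f j)) (fun j => (codingYx G (f j) (C37 j) (C38 j)).bg)
    (fun j => KSCU G (f j) (par j) (C37 j) (C38 j)) (fun j => KSCU G (f j) (par j) (C37 j) (C38 j))
    (fun j => KACU G (f j) (GAY (f j).toKIdx (parS j) (parB j) (GpS j)) (parB j) (C37 j) (C38 j))
    (fun j => KACU G (f j) (GAY (f j).toKIdx (parS j) (parB j) (GpS j)) (parB j) (C37 j) (C38 j))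
    (fun j => pullS (codingYx G (f j) (C37 j) (C38 j)) (Cinv j))
    (C₁ := ℝ × ℝ) (C₂ := ℝ) (pos₁ := fun c => 0 < c.1 ∧ 0 < c.2) (pos₂ := fun c => 0 < c)
    (Blk₁ := fun c j W => EBlock (KACU G (f j) (GAY (f j).toKIdx (parS j) (parB j) (GpS j)) (parB j) (C37 j) (C38 j)) c.1 c.2 W)
    (Blk₂ := fun c j W => GlobBlock (KACU G (f j) (GAY (f j).toKIdx (parS j) (parB j) (GpS j)) (parB j) (C37 j) (C38 j)) c W)
    (fun B₀ δ₀ Bβ Bε Bεβ B₁ δ₁ hB₀ hδ₀ hB₁ hδ₁ =>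
      ⟨0, 1, B₀, δ₀, Bβ, Bε, Bεβ, B₁, δ₁, one_pos, hB₀, hδ₀, hB₁, hδ₁, fun _ _ _ _ _ _ _ hT => hT⟩)
    (fun c hc a ha => ?_)
    (stepEPos_KACU_of_385 f dB c35 G b par parS parB GpS ιB C37 C38 Cinv hι hM₂ hrepr hcR hunitA h385)
  -- the output transfer at the coded product: (3.42) block ⟹ (3.47) block, constant `B·(Cg+1)`, above `Mg(δ)`
  obtain ⟨Mg, Cg, hCg, H⟩ := globBlock_KACU_prod_of_eBlock (𝔸 := 𝔸) (d := d) (ℓ := ℓ) (hd := hd) (hL := hL) (b₀ := b₀) (b₁ := b₁) (Mstar := Mstar) G hc.2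
  refine ⟨Mg, 1, a, c.1 * (Cg + 1), one_pos, ha, le_rfl, mul_pos hc.1 (by linarith), ?_⟩
  intro j hM α₀ hα₀ _ W hreg α₁ _ _ W' h37 hE
  obtain ⟨U, rfl, -⟩ := (codingYx G (f j) (C37 j) (C38 j)).exists_of_bg_Reg335 hreg
  obtain ⟨U', a', hcU, rfl, -⟩ := (codingYx G (f j) (C37 j) (C38 j)).exists_of_bg_Cplx337 h37
  cases hcU
  have hG := H (f j) (ιB j) (hι j) hM (GAY (f j).toKIdx (parS j) (parB j) (GpS j)) (parB j) (C37 j) (C38 j) U a' c.1 hc.1.le hE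
  exact globBlock_mono_const G (f j) _ (parB j) (C37 j) (C38 j) hG (mul_le_mul_of_nonneg_left (by linarith) hc.1.le)

end Step

end Literature.MathematicalPhysics.QuantumFieldTheory.Balaban1983to89.B9SectBGStepCodedFGlob

end
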